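import Mathlib.Data.Finsupp.Fin
import Mathlib.Data.Nat.Choose.Central
import Literature.Barriers.ValiantsHypothesis.GKSS17NaturalProofsPIT
import Literature.Computability.AlgebraicComplexity.ArithCircuitProofs
import HarnessLib

/-!
# GKSS 2017 Def. 1 / Def. 5 / Open Question 1 AT THE FORBES–SHPILKA–VOLK PRESENTATION
# (Grochow–Kumar–Saks–Saraf arXiv:1701.01717 §2–§3 ⟷ Forbes–Shpilka–Volk 2018 Cor. 5 / Question 6;
# cell val-lit, typer t19 — the bridge between `GKSS17NaturalProofsPIT.lean` and
# `AlgebraicNaturalProofs.lean`)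

`GKSS17NaturalProofsPIT.lean` types GKSS's class-level notions ("captures", stretched classes
`VP(N)`, succinct hitting sets of a PRESENTATION `Λ(n)`) and records in its module docstring that
GKSS Open Question 1 (`GKSS2017.openQuestion1_VP`: SOME presentation of `VP` hits `VP(N)`) and the
tree's FSV Question 6 (`SuccinctHittingSetsForVP F`: `∀ a ∃ b`, eventually, in the fixed ambient
`k[x_1..x_n]^{≤ n}`) differ in quantifier structure. This file makes the relation precise for the
FSV presentation itself:

* `card_degLEMonomials` — the count the FSV file cites throughout: `N = |{deg ≤ n monomials in n
  variables}| = binom(2n, n)` [cite: ForbesShpilkaVolk2018, Cor. 5] (general form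
  `ncard_degLE : |{deg ≤ d in v variables}| = binom(v + d, d)`, via `ncard_homMonomials`).
* `captures_smallCircuits_VP` — for every size exponent `b ≥ 1`, the FSV simple classes
  `SmallCircuits F n b` (degree `≤ n`, size `≤ n^b`, in `n` variables) CAPTURE `VP F` in the
  sense of GKSS Def. 1 (`GKSS2017.Captures`): a p-family of p-bounded complexity re-indexes into
  `SmallCircuits F (m n) b` with `m n = nvars + deg + size + 1`.
* `isSuccinctHittingSetFor_smallCircuits_iff` — GKSS Def. 5 for THIS presentation against
  `VP(N)` (`GKSS2017.VPMeta`) is EQUIVALENT to the FSV hitting property UNIFORM in the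
  distinguisher exponent: `∀ a, ∃ n₀, ∀ n ≥ n₀, IsSuccinctHittingSet (degLEMonomials n)
  (SmallCircuits F n b) (Distinguishers F n a)` — "`∃ b ∀ a`" where FSV Question 6 is "`∀ a ∃ b`".
* Hence (`openQuestion1_VP_of_uniform`, `succinctHittingSetsForVP_of_uniform`) the
  uniform hypothesis answers GKSS Open Question 1 (first half) positively AND implies FSV
  Question 6; nothing here claims either open question.

Honest framing: glue between two typed OPEN questions; `VP ≠ VNP` is open and nothing in this
file bears on it.

## References
* [GrochowKumarSaksSaraf2017] arXiv:1701.01717, Def. 1 (p.5), Def. 5 (p.8), Open Question 1 (p.8).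
* [ForbesShpilkaVolk2018] Theory Comput. 14 (2018), Cor. 5 and Question 6 (the classes
  `SmallCircuits`, `Distinguishers`, `N = binom(2n, n)`).
-/

noncomputable section

namespace Literature.Barriers.ValiantsHypothesis.GKSS2017

open Literature.Computability.AlgebraicComplexity MvPolynomial
open Literature.Barriers.ValiantsHypothesis (coeffVector coeffVector_apply degLEMonomials
  SmallCircuits Distinguishers IsSuccinctHittingSet SuccinctHittingSetsForVP)

/-! ### The count `N = binom(v + d, d)` of monomials of degree `≤ d` in `v` variables -/

section Count

/-- Monomials of degree `≤ d` in `v` variables correspond to monomials of degree exactly `d` in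
`v + 1` variables (homogenise with the slack exponent `d - deg m` on a new first variable).
[cite: ForbesShpilkaVolk2018, Cor. 5 (N = binom(n+d, d))] -/
def degLEEquivHom (v d : ℕ) : {m : Fin v →₀ ℕ // m.degree ≤ d} ≃ homMonomials (v + 1) d where
  toFun m := ⟨Finsupp.cons (d - (m : Fin v →₀ ℕ).degree) (m : Fin v →₀ ℕ), by
    show Finsupp.degree _ = d
    rw [Finsupp.degree_eq_sum, Fin.sum_univ_succ, Finsupp.cons_zero]
    simp only [Finsupp.cons_succ]
    rw [← Finsupp.degree_eq_sum, Nat.sub_add_cancel m.2]⟩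
  invFun m := ⟨Finsupp.tail (m : Fin (v + 1) →₀ ℕ), by
    have h : Finsupp.degree (m : Fin (v + 1) →₀ ℕ) = d := m.2
    rw [Finsupp.degree_eq_sum, Fin.sum_univ_succ] at h
    rw [Finsupp.degree_eq_sum]
    simp only [Finsupp.tail_apply]
    omega⟩
  left_inv m := by
    apply Subtype.ext
    exact Finsupp.tail_cons _ _
  right_inv m := by
    apply Subtype.ext
    have h : Finsupp.degree (m : Fin (v + 1) →₀ ℕ) = d := m.2
    rw [Finsupp.degree_eq_sum, Fin.sum_univ_succ] at h
    have ht : Finsupp.degree (Finsupp.tail (m : Fin (v + 1) →₀ ℕ)) =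
        ∑ i : Fin v, (m : Fin (v + 1) →₀ ℕ) i.succ := by
      rw [Finsupp.degree_eq_sum]; simp only [Finsupp.tail_apply]
    show Finsupp.cons _ _ = (m : Fin (v + 1) →₀ ℕ)
    rw [ht, show d - ∑ i : Fin v, (m : Fin (v + 1) →₀ ℕ) i.succ = (m : Fin (v + 1) →₀ ℕ) 0 by
      omega, Finsupp.cons_tail]

/-- **`|{monomials of degree ≤ d in v variables}| = binom(v + d, d)`** (the dimension of
`k[x_1..x_v]^{≤ d}`; FSV: "`N = binom(n + d, d)`"). [cite: ForbesShpilkaVolk2018, Cor. 5] -/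
theorem ncard_degLE (v d : ℕ) : Nat.card {m : Fin v →₀ ℕ // m.degree ≤ d} = (v + d).choose d := by
  rw [Nat.card_congr (degLEEquivHom v d), ncard_homMonomials]
  congr 1
  omega

/-- **`N = binom(2n, n)`**: the number of coefficient variables of the tree's FSV frame
(`degLEMonomials n`, degree `≤ n` in `n` variables), as cited in `AlgebraicNaturalProofs.lean`.
[cite: ForbesShpilkaVolk2018, Cor. 5 and Question 6] -/
theorem card_degLEMonomials (n : ℕ) : Nat.card (degLEMonomials n) = (2 * n).choose n := by
  rw [two_mul]
  exact ncard_degLE n n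

/-- The FSV monomial set is finite (Mathlib `Finsupp.finite_of_degree_le`).
[cite: ForbesShpilkaVolk2018, Cor. 5] -/
theorem degLEMonomials_finite (n : ℕ) : (degLEMonomials n).Finite :=
  Finsupp.finite_of_degree_le n

/-- For `n ≥ 1` there are at least two coefficient variables: `binom(2n, n) ≥ 2`.
[cite: ForbesShpilkaVolk2018, Cor. 5] -/
theorem two_le_card_degLEMonomials {n : ℕ} (hn : 0 < n) : 2 ≤ Nat.card (degLEMonomials n) := by
  rw [card_degLEMonomials, ← Nat.centralBinom_eq_two_mul_choose]
  exact Nat.two_le_centralBinom n hn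

/-- Absorbing the additive constant of a `poly(N)` bound: `N^c + c ≤ N^{c+1}` once `N ≥ 2`.
[folklore] -/
private theorem pow_add_self_le_pow_succ {N c : ℕ} (hN : 2 ≤ N) : N ^ c + c ≤ N ^ (c + 1) := by
  have h1 : c < 2 ^ c := c.lt_two_pow_self
  have h2 : 2 ^ c ≤ N ^ c := Nat.pow_le_pow_left hN c
  calc N ^ c + c ≤ N ^ c + N ^ c := by omega
    _ = N ^ c * 2 := by ring
    _ ≤ N ^ c * N := Nat.mul_le_mul_left _ hN
    _ = N ^ (c + 1) := by ring

end Count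

/-! ### The FSV simple classes present `VP` (GKSS Def. 1) -/

section Presentation

variable (F : Type*) [Field F]

/-- Members of `SmallCircuits F n b` have degree `≤ n`, so their monomials lie in
`degLEMonomials n` — the presentation lives in the ambient spanned by the FSV coefficient index
set. [cite: ForbesShpilkaVolk2018, Cor. 5] -/
theorem support_subset_degLEMonomials {n b : ℕ} {f : MvPolynomial (Fin n) F}
    (hf : f ∈ SmallCircuits F n b) : ∀ m ∈ f.support, m ∈ degLEMonomials n := by
  intro m hm
  show m.degree ≤ n
  have h := (le_totalDegree hm).trans hf.1
  simpa [Finsupp.degree_apply, Finsupp.sum] using h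

/-- **The FSV classes capture `VP` (GKSS Def. 1 for FSV Cor. 5's `𝒞`).** For every `b ≥ 1`, the
level sets `SmallCircuits F n b` (`n` variables, degree `≤ n`, fan-in-two size `≤ n^b`) capture
`VP F`: (1) a family through them is a p-family of p-bounded complexity; (2) a `VP` family with
`nvars_n` variables, degree `d_n` and size `s_n` (all p-bounded) re-indexes, along the variable
embedding `Fin nvars_n ↪ Fin (m n)`, into `SmallCircuits F (m n) b` for
`m n = nvars_n + d_n + s_n + 1` (renaming does not increase degree or size).
[cite: GrochowKumarSaksSaraf2017, Def. 1, p.5] [cite: ForbesShpilkaVolk2018, Cor. 5] -/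
theorem captures_smallCircuits_VP {b : ℕ} (hb : 1 ≤ b) :
    Captures F (fun n => n) (fun n => SmallCircuits F n b) (VP F) := by
  refine ⟨fun f hf => ⟨⟨⟨1, fun n => by simp⟩, ⟨1, fun n => ?_⟩⟩, ⟨b, fun n => ?_⟩⟩,
    fun T hT => ?_⟩
  · exact (hf n).1.trans (by simp)
  · exact (hf n).2.trans (Nat.le_add_right _ _)
  · obtain ⟨⟨hv, hd⟩, hc⟩ := hT
    have hv' : IsPBounded T.nvars := by simpa using hv
    have hm : IsPBounded fun n =>
        T.nvars n + (T.poly n).totalDegree + complexity (T.poly n) + 1 :=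
      IsPBounded.add_holds (IsPBounded.add_holds (IsPBounded.add_holds hv' hd) hc)
        (IsPBounded.const 1)
    refine ⟨fun n => T.nvars n + (T.poly n).totalDegree + complexity (T.poly n) + 1, hm,
      fun n => ?_⟩
    have h1 : T.nvars n ≤ T.nvars n + (T.poly n).totalDegree + complexity (T.poly n) + 1 := by
      omega
    have h2 : (T.poly n).totalDegree ≤
        T.nvars n + (T.poly n).totalDegree + complexity (T.poly n) + 1 := by omega
    have h3 : complexity (T.poly n) ≤
        (T.nvars n + (T.poly n).totalDegree + complexity (T.poly n) + 1) ^ b :=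
      (Nat.le_self_pow (by omega) _).trans' (by omega)
    refine ⟨Fin.castLE h1, Fin.castLE_injective h1, And.intro ?_ ?_⟩
    · exact (totalDegree_rename_le _ _).trans h2
    · exact (complexity_rename_le_holds' _ _).trans h3

end Presentation

/-! ### GKSS Def. 5 at the FSV presentation = FSV hitting, uniform in the distinguisher level -/

section Hitting

variable (F : Type*) [Field F]

/-- **GKSS Def. 5 for the FSV presentation, unfolded.** The level sets `SmallCircuits F n b` are
a succinct hitting set against `VP(N)` in GKSS's sense (every nowhere-zero `poly(N)`-degree,
`poly(N)`-size family of distinguishers is hit at all large `n`) IFF for every distinguisher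
exponent `a` they eventually hit all of `Distinguishers F n a` — FSV's hitting property with ONE
size exponent `b` serving every `a` ("`∃ b ∀ a`", versus Question 6's "`∀ a ∃ b`",
`SuccinctHittingSetsForVP`). (→): a level-wise counterexample sequence, padded with the constant
`1` at the good levels, is a nowhere-zero `VP(N)` family missed infinitely often; (←): a `VP(N)`
family with constant `c` lies in `Distinguishers F n (c+1)` once `N = binom(2n, n) ≥ 2`.
[cite: GrochowKumarSaksSaraf2017, Def. 5 and Open Question 1, p.8] [cite: ForbesShpilkaVolk2018, Cor. 5 and Question 6] -/
theorem isSuccinctHittingSetFor_smallCircuits_iff (b : ℕ) :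
    IsSuccinctHittingSetFor F (fun n => degLEMonomials n) (fun n => SmallCircuits F n b)
        (VPMeta F (fun n => n) fun n => degLEMonomials n) ↔
      ∀ a : ℕ, ∃ n₀, ∀ n, n₀ ≤ n →
        IsSuccinctHittingSet (degLEMonomials n) (SmallCircuits F n b) (Distinguishers F n a) := by
  classical
  constructor
  · intro h a
    by_contra hcon
    simp only [not_exists, not_forall, exists_prop] at hcon
    -- `bad n`: a nonzero level-`a` distinguisher missed by `SmallCircuits F n b`
    let bad : ∀ n, Prop := fun n => ∃ D ∈ Distinguishers F n a, D ≠ 0 ∧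
      ∀ f ∈ SmallCircuits F n b, eval (coeffVector (degLEMonomials n) f) D = 0
    have hbad : ∀ n₀, ∃ n, n₀ ≤ n ∧ bad n := by
      intro n₀
      obtain ⟨n, hn, hno⟩ := hcon n₀
      simp only [IsSuccinctHittingSet, not_forall, not_exists, exists_prop, not_and, not_not]
        at hno
      obtain ⟨D, hD, hD0, hmiss⟩ := hno
      exact ⟨n, hn, D, hD, hD0, fun f hf => hmiss f hf⟩
    let T : ∀ n, MvPolynomial (degLEMonomials n) F := fun n =>
      if hn : bad n then hn.choose else 1
    have hT : T ∈ VPMeta F (fun n => n) fun n => degLEMonomials n := by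
      refine ⟨a, fun n => ?_⟩
      by_cases hn : bad n
      · have hD := hn.choose_spec.1
        simp only [T, dif_pos hn]
        rw [card_degLEMonomials]
        exact ⟨hD.2.trans (Nat.le_add_right _ _), hD.1.trans (Nat.le_add_right _ _)⟩
      · simp only [T, dif_neg hn, totalDegree_one, zero_le, true_and]
        rw [← C_1, complexity_C_holds]
        exact Nat.zero_le _
    have hT0 : ∀ n, T n ≠ 0 := by
      intro n
      by_cases hn : bad n
      · simp only [T, dif_pos hn]; exact hn.choose_spec.2.1
      · simp only [T, dif_neg hn]; exact one_ne_zero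
    obtain ⟨n₀, hn₀⟩ := h T hT hT0
    obtain ⟨n, hn, hbn⟩ := hbad n₀
    obtain ⟨f, hf, hne⟩ := hn₀ n hn
    apply hne
    simp only [T, dif_pos hbn]
    exact hbn.choose_spec.2.2 f hf
  · rintro h T ⟨c, hc⟩ hT0
    obtain ⟨n₀, hn₀⟩ := h (c + 1)
    refine ⟨max n₀ 1, fun n hn => ?_⟩
    have hn₀' : n₀ ≤ n := (le_max_left _ _).trans hn
    have hn1 : 0 < n := (le_max_right _ _).trans hn
    have hN := two_le_card_degLEMonomials hn1
    have hD : T n ∈ Distinguishers F n (c + 1) := by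
      have key : Nat.card (degLEMonomials n) ^ c + c ≤ ((2 * n).choose n) ^ (c + 1) := by
        rw [← card_degLEMonomials]; exact pow_add_self_le_pow_succ hN
      exact ⟨(hc n).2.trans key, (hc n).1.trans key⟩
    exact hn₀ n hn₀' (T n) hD (hT0 n)

/-- **The uniform FSV hypothesis answers GKSS Open Question 1 (first half) — for the FSV
presentation.** If ONE size exponent `b ≥ 1` hits every distinguisher level eventually, then `VP`
is a succinct hitting set against `VP` in GKSS's class-level sense (`GKSS2017.openQuestion1_VP`,
witnessed by the presentation `SmallCircuits F · b` in the ambient `degLEMonomials`). The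
hypothesis is OPEN (it implies FSV Question 6, `succinctHittingSetsForVP_of_uniform`); nothing is
asserted about it. [cite: GrochowKumarSaksSaraf2017, Open Question 1, p.8] [cite: ForbesShpilkaVolk2018, Question 6] -/
theorem openQuestion1_VP_of_uniform {b : ℕ} (hb : 1 ≤ b)
    (h : ∀ a : ℕ, ∃ n₀, ∀ n, n₀ ≤ n →
      IsSuccinctHittingSet (degLEMonomials n) (SmallCircuits F n b) (Distinguishers F n a)) :
    openQuestion1_VP F :=
  ⟨fun n => n, fun n => degLEMonomials n, fun n => SmallCircuits F n b, degLEMonomials_finite,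
    fun _ _ hf => support_subset_degLEMonomials F hf, captures_smallCircuits_VP F hb,
    (isSuccinctHittingSetFor_smallCircuits_iff F b).2 h⟩

/-- The uniform hypothesis ("`∃ b ∀ a`") trivially implies FSV Question 6 ("`∀ a ∃ b`", the
tree's `SuccinctHittingSetsForVP F`). [cite: ForbesShpilkaVolk2018, Question 6] -/
theorem succinctHittingSetsForVP_of_uniform [Infinite F] {b : ℕ}
    (h : ∀ a : ℕ, ∃ n₀, ∀ n, n₀ ≤ n →
      IsSuccinctHittingSet (degLEMonomials n) (SmallCircuits F n b) (Distinguishers F n a)) :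
    SuccinctHittingSetsForVP F := fun a =>
  let ⟨n₀, hn₀⟩ := h a; ⟨b, n₀, hn₀⟩

/-- Conversely, GKSS Def. 5 for the FSV presentation at exponent `b` gives FSV Question 6
(through the uniform form). [cite: GrochowKumarSaksSaraf2017, Def. 5, p.8] [cite: ForbesShpilkaVolk2018, Question 6] -/
theorem succinctHittingSetsForVP_of_isSuccinctHittingSetFor_smallCircuits [Infinite F] {b : ℕ}
    (h : IsSuccinctHittingSetFor F (fun n => degLEMonomials n) (fun n => SmallCircuits F n b)
      (VPMeta F (fun n => n) fun n => degLEMonomials n)) :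
    SuccinctHittingSetsForVP F :=
  succinctHittingSetsForVP_of_uniform F ((isSuccinctHittingSetFor_smallCircuits_iff F b).1 h)

end Hitting

end Literature.Barriers.ValiantsHypothesis.GKSS2017
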